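import Summits.QuantumAdvantage.QuantumAdvantage.Theses.SpinorFlattening
import Literature.Computability.QuantumComplexity.GaussianRank
import Literature.Computability.QuantumComplexity.StabilizerSimulationMagicT

/-!
# Disproof of `NegApproxGaussRankSuperpoly` (stmt-QuantumAdvantage-1245) — findings

Standing adversary work file (refuter-cdisprove-stmt-QuantumAdvantage-1245-0, generation 1,
2026-08-16).  Crux (route SpinorFlattening, KILL item, rank 2):
`∃ δ ∈ (0,1) ∀ c ∃ t ∀ r ≤ t^c + c ∀ (a : Fin r → ℂ) (g : Fin r → QReg (t*4) → ℂ),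
(∀ i, IsGauss (g i)) → δ² < normSq (M^{⊗t} − Σ aᵢ • gᵢ)` — superpolynomial CONSTANT-precision
approximate fermionic Gaussian rank of the matchgate-magic powers `|M⟩^{⊗t}`.

## Verdict of this generation: NO KILL — the crux resists because it is (almost certainly) TRUE
The route's own Clifford-multiplication flattening, read through its Frobenius MASS instead of one
singular value (line `spectral-mass-flattening`, picked by the lead; `stub_massBound` already landed,
p71968), gives `C(t,K)8^K · ‖M^{⊗t} − φ‖² ≥ C(t,K)8^K − r·D_K(4t)` for every `r`-term Gaussian
combination `φ`; with `K ≈ (c+2) log₂ t` (so `K²/t → 0`) the right side is `(1 − o(1))·C(t,K)8^K`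
for all `r ≤ t^c + c`, i.e. the inner claim holds for EVERY `δ < 1`, and the certified approximate
rank is `2^{Ω(√t)}` (singles family) resp. `(1−δ²)·2^{0.33 t}`–`2^{0.497 t}` (optimised `K`, pairs).
I re-derived the four stubs of the skeleton independently (§5 below): none is false.

So this file records, as kernel-checked theorems, WHAT ANY PROOF MUST USE and WHICH NEARBY
STATEMENTS ARE FALSE (for the planner's repair modes and the negatives index):

* §0 `crux_iff_named` — the crux is, by `Iff.rfl`, the named-API statement over
  `IsGaussian` / `magicMPow` / `normSq` (GaussianRank.lean); all variants below edit ONE token of it.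
* §1 toolkit — `normSq_magicMPow` (‖M^{⊗t}‖² = 1), `magicMPow_ne_zero`, the exact `2^{4t}`-term
  Gaussian decomposition `magicMPow_eq_sum_basis`, the two-term decomposition at `t = 1`
  (`magicMPow_one_eq`: χ_G(M) ≤ 2), `one_le_budget` (the budget `t^c + c` is always ≥ 1),
  `isGaussian_zero_qubits` (on 0 qubits every nonzero scalar is Gaussian).
* §2 LOAD-BEARING (drop one hypothesis ⇒ false):
  `false_without_rankBound` (no budget on `r`: the basis decomposition is exact),
  `false_without_gaussianity` (dictionary = all nonzero vectors: `M^{⊗t}` itself, `r = 1`),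
  `false_without_linearIndependence` (IsGauss minus `LinearIndependent ℂ A`: `A = 0` annihilates
  everything), `false_without_annihilation` (IsGauss minus the annihilation equations).
  ⇒ any proof uses the budget AND the annihilator structure of the dictionary (the line does: the
  normal-ordering deficiency `stub_deficiency` is exactly where `n` independent annihilators enter).
* §3 TIGHTNESS of the constant: `not_inner_of_one_le` — for `δ ≥ 1` the inner claim fails at
  `r = 0` for every `c, t` (‖M^{⊗t} − 0‖² = 1), so `δ < 1` is forced, and the line's "every δ < 1"
  is the most one can ask; `no_witness_t_zero`, `no_witness_t_one` — the crux prover's `t` can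
  never be `0` (dictionary = all of ℂ^×) nor `1` when `c ≥ 1` (χ_G(M) = 2).
* §4 NATURAL STRENGTHENINGS REFUTED: `not_uniformT` (quantifier swap `∃ t ∀ c`: false, exact
  rank ≤ 2^{4t}), `not_allPosT` (`∀ c ∀ t > 0` instead of `∃ t`: false at `t = 1, c = 1, r = 2`).
  NOT refutable (consequences of the line, recorded so nobody files them as kills): the
  `∀ δ ∈ (0,1)` version and the exponential version `r ≤ 2^{⌊t/4⌋}`-budget.
* §5 TARGETS (the lead's stubs; payload.stuck_stubs = []): none broken — see the comments there
  for the vetting of each (small models, edge cases `n = 0`, `K > n`, repeated labels in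
  `stub_deficiency`'s lists, Jordan–Wigner signs in `stub_flatOrthonormal`).
* §6 NEAR-MISSES / OPEN: exact-rank tightness `χ_G(M^{⊗t}) = 2^t`? (t = 2 is crux 1248,
  `χ_G(M⊗M) ∈ {3,4}`); the true constant-δ exponent (line certifies ≤ 0.497·t bits, trivial upper
  bound `t` bits).

Everything outside §5–§6 is sorry-free and has LANDED in the tree (import these, not this work
file): §0–§4 = `Theorems/NegApproxGaussRankSuperpoly/Negative/LoadBearing.lean` (p72762; same
theorem names without the variant `def`s, namespace `…Theorems.NegApproxGaussRankSuperpoly.Negative`),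
§4b = `Theorems/NegApproxGaussRankSuperpoly/Negative/StubSimplifications.lean` (p73069).  This
generation keeps the proofs inline so that the work file elaborates independently of the farm's
build state; the next generation switches to the imports.
-/

noncomputable section

set_option linter.dupNamespace false

namespace Summit.QuantumAdvantage.QuantumAdvantage.Cruxes.NegApproxGaussRankSuperpoly.Disproof

open Literature.Computability.Cryptography Literature.Computability.QuantumComplexity Matrix Finset
open Summit.QuantumAdvantage.QuantumAdvantage.Theses.SpinorFlattening (NegApproxGaussRankSuperpoly)

/-! ## §0 The crux over the named API -/

/-- The crux is LITERALLY (by `Iff.rfl`) the named-API statement: the route's inline `maj`,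
`IsGauss`, `Mpow` unfold to `majorana`, `IsGaussian`, `magicMPow`. [folklore] -/
theorem crux_iff_named : NegApproxGaussRankSuperpoly ↔
    (∃ δ : ℝ, 0 < δ ∧ δ < 1 ∧ ∀ c : ℕ, ∃ t : ℕ, ∀ r : ℕ, r ≤ t ^ c + c →
      ∀ (a : Fin r → ℂ) (g : Fin r → QReg (t * 4) → ℂ), (∀ i, IsGaussian (g i)) →
        δ ^ 2 < normSq (magicMPow t - ∑ i, a i • g i)) :=
  Iff.rfl

/-! ## §1 Toolkit -/

/-- `‖0‖² = 0`. [folklore] -/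
theorem normSq_zero_vec (n : ℕ) : normSq (0 : QReg n → ℂ) = 0 := by
  simp [normSq]

/-- `√2 ≠ 0` in `ℂ`. [folklore] -/
theorem sqrt_two_ne_zero : (Real.sqrt 2 : ℂ) ≠ 0 :=
  Complex.ofReal_ne_zero.2 (Real.sqrt_ne_zero'.2 two_pos)

/-- The amplitude of `|M⟩^{⊗t}` on a constant bit string is `(√2)^{-t}`. [folklore] -/
theorem magicMPow_apply_const (t : ℕ) (b : Bool) :
    magicMPow t (fun _ => b) = ((Real.sqrt 2 : ℂ)⁻¹) ^ t := by
  classical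
  rw [magicMPow_apply, if_pos (fun _ _ => rfl)]

/-- `|M⟩^{⊗t} ≠ 0`. [folklore] -/
theorem magicMPow_ne_zero (t : ℕ) : magicMPow t ≠ 0 := by
  intro h
  have h1 := congrFun h (fun _ => false)
  rw [magicMPow_apply_const, Pi.zero_apply] at h1
  exact pow_ne_zero _ (inv_ne_zero sqrt_two_ne_zero) h1

/-- `‖ |M⟩^{⊗t} ‖² = 1` (tensor recursion `magicMPow_succ` and multiplicativity of the norm).
[folklore] -/
theorem normSq_magicMPow (t : ℕ) : normSq (magicMPow t) = 1 := by
  induction t with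
  | zero =>
    rw [magicMPow_zero]
    simp [normSq]
  | succ t ih =>
    have key : normSq (magicMPow (t + 1)) = normSq (tensorVec (magicMPow t) magicM) := by
      unfold normSq
      refine Fintype.sum_equiv ⟨fun x m => x (Fin.cast (add_one_mul t 4).symm m),
        fun z j => z (Fin.cast (add_one_mul t 4) j), fun x => ?_, fun z => ?_⟩ _ _ (fun x => ?_)
      · funext j; simp
      · funext m; simp
      · rw [magicMPow_succ]
        rfl
    rw [key, normSq_tensorVec, ih, normSq_magicM, one_mul]

/-- `|QReg n| = 2ⁿ`. [folklore] -/
theorem card_QReg (n : ℕ) : Fintype.card (QReg n) = 2 ^ n := by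
  simp

/-- EXACT `2^{4t}`-TERM GAUSSIAN DECOMPOSITION: `|M⟩^{⊗t} = Σ_x M^{⊗t}(x) |x⟩` over the
computational basis (every `|x⟩` is Gaussian, `basisState_isGaussian`), indexed by `Fin (2^{4t})`.
So the exact Gaussian rank is `≤ 2^{4t}` (indeed `≤ 2^t`, not needed here). [folklore] -/
theorem magicMPow_eq_sum_basis (t : ℕ) :
    ∃ e : QReg (t * 4) ≃ Fin (2 ^ (t * 4)), magicMPow t =
      ∑ i : Fin (2 ^ (t * 4)), magicMPow t (e.symm i) • basisState (e.symm i) := by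
  refine ⟨Fintype.equivFinOfCardEq (card_QReg _), ?_⟩
  set e := Fintype.equivFinOfCardEq (card_QReg (t * 4))
  calc magicMPow t = ∑ x, magicMPow t x • basisState x :=
        state_eq_sum_amplitude_smul_basisState _
    _ = _ := (Equiv.sum_comp e.symm (fun x => magicMPow t x • basisState x)).symm

/-- TWO-TERM DECOMPOSITION AT `t = 1`: `|M⟩ = (√2)⁻¹ |0000⟩ + (√2)⁻¹ |1111⟩` — two Gaussian
(basis) states, so `χ_G(M) ≤ 2`. [cite: CudbyStrelchuk2023, §6 (χ_G(|M⟩) = 2)] -/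
theorem magicMPow_one_eq :
    (magicMPow 1 : QReg (1 * 4) → ℂ) =
      ∑ i : Fin 2, (fun _ : Fin 2 => ((Real.sqrt 2 : ℂ)⁻¹)) i •
        (![basisState (fun _ => false), basisState (fun _ => true)] :
          Fin 2 → QReg (1 * 4) → ℂ) i := by
  funext x
  rw [magicMPow_one x]
  simp [magicM, Fin.sum_univ_two, Finset.sum_apply, mul_add]

/-- The budget `t^c + c` is always at least `1` (so `r = 1` is always admissible). [folklore] -/
theorem one_le_budget (t c : ℕ) : 1 ≤ t ^ c + c := by
  rcases c with _ | k
  · simp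
  · have : 0 ≤ t ^ (k + 1) := Nat.zero_le _
    omega

/-- On `0` qubits every nonzero amplitude is Gaussian (no annihilator is asked for). [folklore] -/
theorem isGaussian_zero_qubits (ψ : QReg 0 → ℂ) (h : ψ ≠ 0) : IsGaussian ψ :=
  ⟨h, fun k => k.elim0, linearIndependent_empty_type, fun k => k.elim0⟩

/-- The standard `n` independent coefficient rows `A k p = [p.1 = k]` (used to show that the
annihilation equations, not the mere existence of independent rows, carry the content). [folklore] -/
theorem linearIndependent_rows (n : ℕ) :
    LinearIndependent ℂ (fun (k : Fin n) (p : Fin n × Bool) => if p.1 = k then (1 : ℂ) else 0) := by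
  rw [Fintype.linearIndependent_iff]
  intro g hg k
  have h := congrFun hg (k, false)
  simp only [Finset.sum_apply, Pi.smul_apply, smul_eq_mul, Pi.zero_apply] at h
  simpa using h

/-! ## §2 LOAD-BEARING hypotheses: drop one ⇒ false -/

/-- The crux with the rank BUDGET `r ≤ t^c + c` dropped. [folklore] -/
def WithoutRankBound : Prop :=
  ∃ δ : ℝ, 0 < δ ∧ δ < 1 ∧ ∀ c : ℕ, ∃ t : ℕ, ∀ r : ℕ,
    ∀ (a : Fin r → ℂ) (g : Fin r → QReg (t * 4) → ℂ), (∀ i, IsGaussian (g i)) →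
      δ ^ 2 < normSq (magicMPow t - ∑ i, a i • g i)

/-- LOAD-BEARING (budget): without `r ≤ t^c + c` the statement is false — the `2^{4t}` computational
basis states decompose `|M⟩^{⊗t}` exactly. [folklore] -/
theorem false_without_rankBound : ¬ WithoutRankBound := by
  rintro ⟨δ, -, -, h⟩
  obtain ⟨t, ht⟩ := h 0
  obtain ⟨e, he⟩ := magicMPow_eq_sum_basis t
  have key := ht (2 ^ (t * 4)) (fun i => magicMPow t (e.symm i)) (fun i => basisState (e.symm i))
    (fun i => basisState_isGaussian _)
  rw [← he, sub_self, normSq_zero_vec] at key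
  exact absurd key (not_lt.2 (sq_nonneg δ))

/-- The crux with GAUSSIANITY dropped: the dictionary is all nonzero vectors. [folklore] -/
def WithoutGaussianity : Prop :=
  ∃ δ : ℝ, 0 < δ ∧ δ < 1 ∧ ∀ c : ℕ, ∃ t : ℕ, ∀ r : ℕ, r ≤ t ^ c + c →
    ∀ (a : Fin r → ℂ) (g : Fin r → QReg (t * 4) → ℂ), (∀ i, g i ≠ 0) →
      δ ^ 2 < normSq (magicMPow t - ∑ i, a i • g i)

/-- LOAD-BEARING (dictionary): if any nonzero vector counts, `|M⟩^{⊗t}` itself is one term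
(`r = 1 ≤ t^c + c` always). [folklore] -/
theorem false_without_gaussianity : ¬ WithoutGaussianity := by
  rintro ⟨δ, -, -, h⟩
  obtain ⟨t, ht⟩ := h 0
  have key := ht 1 (one_le_budget t 0) (fun _ => 1) (fun _ => magicMPow t)
    (fun _ => magicMPow_ne_zero t)
  rw [Fin.sum_univ_one, one_smul, sub_self, normSq_zero_vec] at key
  exact absurd key (not_lt.2 (sq_nonneg δ))

/-- The crux with `LinearIndependent ℂ A` dropped from `IsGauss` (keep `ψ ≠ 0` and the `n`
annihilation equations, but the rows `A k` may be dependent — e.g. all zero). [folklore] -/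
def WithoutLinearIndependence : Prop :=
  ∃ δ : ℝ, 0 < δ ∧ δ < 1 ∧ ∀ c : ℕ, ∃ t : ℕ, ∀ r : ℕ, r ≤ t ^ c + c →
    ∀ (a : Fin r → ℂ) (g : Fin r → QReg (t * 4) → ℂ),
      (∀ i, g i ≠ 0 ∧ ∃ A : Fin (t * 4) → (Fin (t * 4) × Bool → ℂ),
        ∀ k, (∑ p : Fin (t * 4) × Bool, A k p • majorana (t * 4) p.1 p.2) *ᵥ g i = 0) →
      δ ^ 2 < normSq (magicMPow t - ∑ i, a i • g i)

/-- LOAD-BEARING (independence of the annihilators): with `A = 0` allowed, every nonzero vector is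
"Gaussian", in particular `|M⟩^{⊗t}`. [folklore] -/
theorem false_without_linearIndependence : ¬ WithoutLinearIndependence := by
  rintro ⟨δ, -, -, h⟩
  obtain ⟨t, ht⟩ := h 0
  have key := ht 1 (one_le_budget t 0) (fun _ => 1) (fun _ => magicMPow t)
    (fun _ => ⟨magicMPow_ne_zero t, fun _ _ => 0, fun k => by simp⟩)
  rw [Fin.sum_univ_one, one_smul, sub_self, normSq_zero_vec] at key
  exact absurd key (not_lt.2 (sq_nonneg δ))

/-- The crux with the ANNIHILATION EQUATIONS dropped from `IsGauss` (keep `ψ ≠ 0` and the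
existence of `n` independent coefficient rows, which is vacuous). [folklore] -/
def WithoutAnnihilation : Prop :=
  ∃ δ : ℝ, 0 < δ ∧ δ < 1 ∧ ∀ c : ℕ, ∃ t : ℕ, ∀ r : ℕ, r ≤ t ^ c + c →
    ∀ (a : Fin r → ℂ) (g : Fin r → QReg (t * 4) → ℂ),
      (∀ i, g i ≠ 0 ∧ ∃ A : Fin (t * 4) → (Fin (t * 4) × Bool → ℂ), LinearIndependent ℂ A) →
      δ ^ 2 < normSq (magicMPow t - ∑ i, a i • g i)

/-- LOAD-BEARING (the annihilation equations): independent rows always exist, so again every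
nonzero vector would count. [folklore] -/
theorem false_without_annihilation : ¬ WithoutAnnihilation := by
  rintro ⟨δ, -, -, h⟩
  obtain ⟨t, ht⟩ := h 0
  have key := ht 1 (one_le_budget t 0) (fun _ => 1) (fun _ => magicMPow t)
    (fun _ => ⟨magicMPow_ne_zero t, _, linearIndependent_rows (t * 4)⟩)
  rw [Fin.sum_univ_one, one_smul, sub_self, normSq_zero_vec] at key
  exact absurd key (not_lt.2 (sq_nonneg δ))

/-! ## §3 TIGHTNESS of the constant and excluded witnesses -/

/-- TIGHT AT `δ = 1`: for `δ ≥ 1` the inner claim fails for EVERY `c` and EVERY `t`, already at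
`r = 0` (the empty combination is at squared distance exactly `‖M^{⊗t}‖² = 1`).  So the crux's
side condition `δ < 1` is forced, and "every `δ < 1`" (what the line proves) is best possible.
[folklore] -/
theorem not_inner_of_one_le (δ : ℝ) (hδ : 1 ≤ δ) (c t : ℕ) :
    ¬ (∀ r : ℕ, r ≤ t ^ c + c → ∀ (a : Fin r → ℂ) (g : Fin r → QReg (t * 4) → ℂ),
        (∀ i, IsGaussian (g i)) → δ ^ 2 < normSq (magicMPow t - ∑ i, a i • g i)) := by
  intro h
  have key := h 0 (Nat.zero_le _) Fin.elim0 Fin.elim0 (fun i => i.elim0)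
  rw [Finset.univ_eq_empty, Finset.sum_empty, sub_zero, normSq_magicMPow] at key
  nlinarith

/-- The `δ = 1` version of the crux body (for the record: false). [folklore] -/
def AtDeltaOne : Prop :=
  ∀ c : ℕ, ∃ t : ℕ, ∀ r : ℕ, r ≤ t ^ c + c →
    ∀ (a : Fin r → ℂ) (g : Fin r → QReg (t * 4) → ℂ), (∀ i, IsGaussian (g i)) →
      (1 : ℝ) ^ 2 < normSq (magicMPow t - ∑ i, a i • g i)

/-- `δ = 1` is impossible. [folklore] -/
theorem not_atDeltaOne : ¬ AtDeltaOne := by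
  intro h
  obtain ⟨t, ht⟩ := h 0
  exact not_inner_of_one_le 1 le_rfl 0 t ht

/-- EXCLUDED WITNESS `t = 0`: on zero qubits the dictionary is all of `ℂ^×`, so the crux prover's
`t` is never `0` (for any `δ > 0` and any `c`). [folklore] -/
theorem no_witness_t_zero (δ : ℝ) (c : ℕ) :
    ¬ (∀ r : ℕ, r ≤ 0 ^ c + c → ∀ (a : Fin r → ℂ) (g : Fin r → QReg (0 * 4) → ℂ),
        (∀ i, IsGaussian (g i)) → δ ^ 2 < normSq (magicMPow 0 - ∑ i, a i • g i)) := by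
  intro h
  have key := h 1 (one_le_budget 0 c) (fun _ => 1) (fun _ => magicMPow 0)
    (fun _ => isGaussian_zero_qubits _ (magicMPow_ne_zero 0))
  rw [Fin.sum_univ_one, one_smul, sub_self, normSq_zero_vec] at key
  exact absurd key (not_lt.2 (sq_nonneg δ))

/-- EXCLUDED WITNESS `t = 1` (for `c ≥ 1`): `χ_G(M) ≤ 2 ≤ 1^c + c`. [folklore] -/
theorem no_witness_t_one (δ : ℝ) (c : ℕ) (hc : 1 ≤ c) :
    ¬ (∀ r : ℕ, r ≤ 1 ^ c + c → ∀ (a : Fin r → ℂ) (g : Fin r → QReg (1 * 4) → ℂ),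
        (∀ i, IsGaussian (g i)) → δ ^ 2 < normSq (magicMPow 1 - ∑ i, a i • g i)) := by
  intro h
  have key := h 2 (by rw [one_pow]; omega) (fun _ => ((Real.sqrt 2 : ℂ)⁻¹))
    ![basisState (fun _ => false), basisState (fun _ => true)]
    (fun i => by fin_cases i <;> exact basisState_isGaussian _)
  rw [← magicMPow_one_eq, sub_self, normSq_zero_vec] at key
  exact absurd key (not_lt.2 (sq_nonneg δ))

/-! ## §4 NATURAL STRENGTHENINGS refuted -/

/-- Quantifier swap: ONE `t` serving every `c`. [folklore] -/
def UniformT : Prop :=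
  ∃ δ : ℝ, 0 < δ ∧ δ < 1 ∧ ∃ t : ℕ, ∀ c : ℕ, ∀ r : ℕ, r ≤ t ^ c + c →
    ∀ (a : Fin r → ℂ) (g : Fin r → QReg (t * 4) → ℂ), (∀ i, IsGaussian (g i)) →
      δ ^ 2 < normSq (magicMPow t - ∑ i, a i • g i)

/-- `∃ t ∀ c` is false: at fixed `t` the budget `t^c + c` eventually exceeds the exact rank
(`≤ 2^{4t}`). [folklore] -/
theorem not_uniformT : ¬ UniformT := by
  rintro ⟨δ, -, -, t, h⟩
  obtain ⟨e, he⟩ := magicMPow_eq_sum_basis t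
  have key := h (2 ^ (t * 4)) (2 ^ (t * 4)) (Nat.le_add_left _ _)
    (fun i => magicMPow t (e.symm i)) (fun i => basisState (e.symm i))
    (fun i => basisState_isGaussian _)
  rw [← he, sub_self, normSq_zero_vec] at key
  exact absurd key (not_lt.2 (sq_nonneg δ))

/-- `∀ t > 0` instead of `∃ t`. [folklore] -/
def AllPosT : Prop :=
  ∃ δ : ℝ, 0 < δ ∧ δ < 1 ∧ ∀ c : ℕ, ∀ t : ℕ, 0 < t → ∀ r : ℕ, r ≤ t ^ c + c →
    ∀ (a : Fin r → ℂ) (g : Fin r → QReg (t * 4) → ℂ), (∀ i, IsGaussian (g i)) →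
      δ ^ 2 < normSq (magicMPow t - ∑ i, a i • g i)

/-- `∀ c ∀ t > 0` is false: `t = 1, c = 1, r = 2` (two basis states give `|M⟩` exactly). Any true
uniform-in-`t` version needs `t ≥ t₀(c)` with `2^{Θ(t₀)} > t₀^c` at least. [folklore] -/
theorem not_allPosT : ¬ AllPosT := by
  rintro ⟨δ, -, -, h⟩
  exact no_witness_t_one δ 1 le_rfl (h 1 1 one_pos)

/-! ## §4b TEMPTING SIMPLIFICATIONS of the line's stubs that are FALSE (for the stub workers)

`not_deficiency_topDegreeOnly` below LANDED as `…/Negative/StubSimplifications.lean` (p73069).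
Not worth a theorem but recorded: `stub_countGap` is FALSE with the singles family at `K = t`
(`D_t(4t) ≥ C(4t,t) ≈ 2^{3.245 t} > 8^t`; numerically `2(t+1)·D_t(4t) > 8^t` for every `t ≤ 80`
and asymptotically), so the count must use an intermediate `K` (`4t/7`, `⌊t/4⌋`, or the
`K = 2^(2c+6)`, `t = 4K` of the attached `CountGap.lean`) — `K = t` is only right for the PAIRS
family of the idea card (`[z^t](1+8z+7z²)^t`). -/

/-- One cannot replace the deficiency `D_K(n) = Σ_{j ≤ K, j ≡ K (2)} C(n,j)` in `stub_deficiency`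
by its top term `C(n,K)`: words with REPEATED letters (allowed by the stub's `List` signature) land
in LOWER degrees.  Witness `n = 1, K = 2, r = 1`: `c_X c_X |0⟩ = |0⟩ ≠ 0` would have to lie in a
subspace of dimension `≤ C(1,2) = 0`.  (For repetition-free words the top-term bound fails too,
from `n = 2` on: `span{c_S |00⟩ : |S| = 2} ∋ |00⟩, |11⟩`.) [folklore] -/
theorem not_deficiency_topDegreeOnly :
    ¬ (∀ (n K r : ℕ) (a : Fin r → ℂ) (g : Fin r → QReg n → ℂ), (∀ i, IsGaussian (g i)) →
        ∃ W : Submodule ℂ (QReg n → ℂ), Module.finrank ℂ W ≤ r * n.choose K ∧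
          ∀ l : List (Fin n × Bool), l.length = K →
            (l.map fun p => majorana n p.1 p.2).prod *ᵥ (∑ i, a i • g i) ∈ W) := by
  intro h
  obtain ⟨W, hW, hmem⟩ := h 1 2 1 (fun _ => 1) (fun _ => basisState (fun _ => false))
    (fun _ => basisState_isGaussian _)
  have hW0 : W = ⊥ := by
    rw [← Submodule.finrank_eq_zero]
    have h12 : Nat.choose 1 2 = 0 := by decide
    rw [h12, mul_zero] at hW
    omega
  have key := hmem [((0 : Fin 1), false), ((0 : Fin 1), false)] rfl
  rw [hW0, Submodule.mem_bot] at key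
  simp only [List.map_cons, List.map_nil, List.prod_cons, List.prod_nil, mul_one,
    majorana_mul_self, Fin.sum_univ_one, one_smul, Matrix.one_mulVec] at key
  exact basisState_ne_zero _ key

/-! ## §5 TARGETS — the lead's stubs (skeleton `Lines/spectral-mass-flattening.lean`, sha 138761cc…)

payload.stuck_stubs = [] at this generation.  Vetting of the four registered stubs (none broken):

* `stub_massBound` — LANDED (p71968).  True: Σᵢ‖Uᵢψ − Uᵢφ‖² = |ι|‖ψ−φ‖² (isometries) and
  ≥ Σᵢ (1 − ‖P_W Uᵢψ‖²) ≥ |ι| − tr P_W (Bessel).  Edge `ι = ∅`: `−dim W ≤ 0` ✓.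
* `stub_deficiency` — true, including the corner cases an adversary would try:
  (i) lists WITH REPEATED labels are allowed by the signature (`l : List`, not a finset): a word
  `c_p c_p c_q = c_q` has degree `K−2`, same parity — still inside the normal-ordered filtration
  piece `⊕_{j ≤ K, j ≡ K (2)} U^{∧j} g`, so the bound `D_K(n)` is unaffected; (ii) `K > n`: the
  count `Σ_{j≤K, j≡K} C(n,j)` still dominates (terms `j > n` vanish, words of `c(u)`'s longer than
  `n` reduce); (iii) `n = 0`: only `K = 0` has a list, `W = span{φ}`, `dim ≤ r·D_0(0) = r` ✓ (and
  `r = 0 ⇒ φ = 0 ∈ ⊥`); (iv) ANY linear complement `U` of the annihilator row space works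
  (`c(u)c(u') + c(u')c(u) = 2B(u,u')` drops degree by 2 whatever `B(u,u')` is) — isotropy unused,
  as the lead notes; (v) numerically (route review kit j000106, triage bundle): rank{c_S g} = 1, 8,
  29, 64, 99 = D_K(8) for random 8-mode Gaussians of both parities.
* `stub_flatOrthonormal` — true: with `finProdFinEquiv (b,i) = i + 4b` (checked: `(2,1) ↦ 9` in
  `Fin (3*4)`) blocks are CONTIGUOUS in Jordan–Wigner order, so `majorana (t*4) (4b+i) β =
  (Z^{⊗4})^{⊗ b} ⊗ γ_{i,β} ⊗ 1`; in the skeleton's increasing-block `List.prod` order the innermost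
  factor acts first and every full-block `Z^{⊗4}` string hits an UNEXCITED copy of `M`
  (`Z^{⊗4}M = M`), hence `mono s · M^{⊗t} = ⊗_b (γ_{s b} M or M)` with NO sign, and the Gram
  matrix factorises over blocks: `⟨M, γ M⟩ = 0` (one bit flip), `⟨γ_a M, γ_b M⟩ = δ_ab`
  (`γ_aγ_b` flips two bits or is `±iZ_j`; GHZ₄ has zero covariance).  Were the blocks interleaved
  (column-major `finProdFinEquiv`), partial `Z` strings would turn `M` into `GHZ⁻` and the claim
  would need signs — they are not.
* `stub_countGap` — true, and PROVED on the way (by-product, not mine to land): evidence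
  `CountGap.lean` on the item (2026-08-16T01:08Z; rc0, sorry-free, std axioms), theorem
  `CountGapCandidate.stub_countGap_candidate` with VERBATIM the registered stub type; witnesses
  `i = 2^(2c+5)`, `K = 2i`, `t = 8i`: `|𝔉_K| ≥ C(t,K)·8^K` (injection from labelled K-subsets),
  `D_K(4t) ≤ (K+1)·C(4t,K)` (`K ≤ 2t`), `K!·C(4t,K) ≤ (4t)^K = (32i)^K`,
  `K!·C(t,K) ≥ (t+1−K)^K ≥ (6i)^K`, `3^K = 9^i ≥ 8^i = 2^K·2^i`, `2(t^c+c)(K+1) < 2^i`.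
  (Least witnesses, re-computed: c = 0..4 ↦ (t,K) = (2,2), (14,7), (32,18), (54,29), (77,44).)
* Independent adversarial numerics on the two unlanded algebraic stubs: kit job j008626
  (`compute/stubcheck.py`; queued behind a saturated farm at the time of writing — its summary
  auto-attaches to the item): (B) `stub_deficiency` span dimensions with REPEATED-label lists,
  n = 4, 8, r = 1, 2, 3, both parities; (C) exact Gram `= 2^t·I` of the 9^t block-pattern images at
  t = 1, 2, 3 in the skeleton's order, plus the interleaved-wire counterfactual; (A) CAR sanity;
  (D) Gaussian-fidelity samples of M, M⊗M against the flat-family bounds 1/2, 29/64.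
-/

/-! ## §6 NEAR-MISSES / open directions (not claims)

* Exact-rank tightness: is `χ_G(M^{⊗t}) = 2^t`?  Open already at `t = 2` (crux 1248,
  Cudby–Strelchuk conjecture `χ_G(M⊗M) = 4`; all Clifford flattenings certify only `3`).  A
  3-term decomposition of `M⊗M` would NOT touch this crux (sub-multiplicativity would give
  `χ_G ≤ 3^{t/2} = 2^{0.79t}`, still above every certified lower bound).
* The constant-δ exponent: certified `0.333 t` (singles) / `0.497 t` (pairs) bits versus the
  trivial `t` bits; no upper bound below `2^t/δ²`-type sparsification is known to me.
* No printed negative result bears on the crux (grounder g18-13; negatives index for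
  QuantumAdvantage: 1615, 8592, 9863 — unrelated).
-/

end Summit.QuantumAdvantage.QuantumAdvantage.Cruxes.NegApproxGaussRankSuperpoly.Disproof

end
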